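import Mathlib
import HarnessLib
import Summits.HubbardSuperconductivity.HubbardSuperconductivity.Theorems.KLProgrammeLocalisedCooperDefs
import Summits.HubbardSuperconductivity.HubbardSuperconductivity.Theorems.KLProgrammeLocalisedCooperEquivariance
import Summits.HubbardSuperconductivity.HubbardSuperconductivity.Theorems.KLProgrammeCooperVertexBlocks
import Summits.HubbardSuperconductivity.HubbardSuperconductivity.Theorems.KLProgrammeCooperVertexBlocksD4

/-!
# Route `KLProgramme` — the localised Cooper matrix is `D₄`-covariant (given the sector-site equivariance), so C2 applies to
# `klLocBlockInf/Sup`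

Cell gate-hubbard-kl, seat p3; companion of `KLProgrammeLocalisedCooperDefs.lean` (p1's Q-E2 carrier).  The one model fact C2 needs
about the localised, weighted Cooper matrix `A_h = Σ_{ω̄ω̄'} [k = k_ω̄][k' = k_ω̄'] √w_ω̄ 𝒞_h(k_ω̄, k_ω̄') √w_ω̄'` is its covariance
`A_h(γk, γk') = A_h(k, k')`.  The Cooper amplitude of the countertermed action is covariant unconditionally
(`klCooperAmplitude_d4Site`, from the tree's `cooperAmplitude_d4Site` + `kernel_hubbardEffectiveActionCT_d4Field`); what remains is
GEOMETRIC — the sector sites and weights are permuted among themselves by `D₄` — and is isolated here as the explicit hypothesis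
`hπ` of every theorem (for each `γ` a permutation `σ` of the sector indices with `k_{σω̄} = γ k_ω̄`, `w_{σω̄} = w_ω̄`), DISCHARGED in
`KLProgrammeLocalisedCooperEquivariance.lean` (`klLocCooper_sectorEquivariance`: `-4 < μ < 0`, `n ≥ 1`, shell off the origin and the
zone boundary) — the `_of_regime` versions at the end of this file take those regime hypotheses instead of `hπ`:

* `klCooperAmplitude_d4Site`; `klLocCooperMatrix_d4Site` — covariance of `A_h` under the sector-site equivariance hypothesis `hπ`;
* `klLocCooperOp_comm`, **`klLocBlockInf_eq_formInf`** / `klLocBlockSup_eq_formSup` — the (B1)/(E2) block bottoms/tops ARE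
  `formInf`/`formSup` of block operators (so `blockFlow_envelopes`, `attractive_upper_envelope`, … apply), and
  **`le_formInf_klLocCooperOp`** — block-by-block control of the localised Cooper operator;
* `klLocBlockInf_eq_formInf_of_regime` / `klLocBlockSup_eq_formSup_of_regime` / `klLocCooperOp_comm_of_regime` /
  **`le_formInf_klLocCooperOp_of_regime`** — the same with `hπ` discharged (regime hypotheses `-4 < μ < 0`, `1 ≤ n`,
  `∀ k ∈ shell_n, k ≠ 0 ∧ ∀ j, 2(k j).val ≠ L`; the last follows from `Λ_n + Σ|κ| < min(-μ, 4+μ)` by `momentumShell_regular`).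

References: HOME/p1/ENGINE-PRED.md §0 Q-E2, (E2); HOME/p3/C2-LEAN-GUIDE.md §2–§4.
-/

noncomputable section

namespace Summit.HubbardSuperconductivity.HubbardSuperconductivity.Theorems.KLProgrammeLegKernels

set_option linter.dupNamespace false -- summit = problem name (single-conjunct summit), D-0017

open scoped InnerProductSpace
open Real Literature.MathematicalPhysics.QuantumLattice Literature.Probability.LatticeModels
open Summit.HubbardSuperconductivity.HubbardSuperconductivity.Theorems.CooperVertexBlocks
open Summit.HubbardSuperconductivity.HubbardSuperconductivity.Theorems.CooperChannelRiccatiFlow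

variable (L M : ℕ) [NeZero L] [NeZero M]

/-- **The Cooper amplitude of the scale-`h` action is `D₄`-covariant:** `𝒞_h(γk, γk') = 𝒞_h(k, k')` (the countertermed effective
action's kernels are `D₄`-invariant, tree `kernel_hubbardEffectiveActionCT_d4Field`, and `cooperAmplitude_d4Site`). -/
theorem klCooperAmplitude_d4Site (β U μ : ℝ) (K : TrigPolyC4v) (e₀ : ℝ) (n : ℕ) (γ : DihedralGroup 4) (k k' : TorusSite 2 L) :
    klCooperAmplitude L M β U μ K e₀ n (d4Site γ k) (d4Site γ k') = klCooperAmplitude L M β U μ K e₀ n k k' :=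
  cooperAmplitude_d4Site L M (kernel_hubbardEffectiveActionCT_d4Field L M γ β U μ K (klScale e₀ n)) β k k'

/-- **Covariance of the localised Cooper matrix:** under the sector-site equivariance hypothesis `hπ`, `A_h(γk, γk') = A_h(k, k')`. -/
theorem klLocCooperMatrix_d4Site {β U μ : ℝ} {K : TrigPolyC4v} {e₀ : ℝ} {n : ℕ}
    (hπ : ∀ γ : DihedralGroup 4, ∃ σ : Equiv.Perm (Fin (sectorCount (2 * n))),
      (∀ ω, klSectorSite L μ n (σ ω) = d4Site γ (klSectorSite L μ n ω)) ∧
      (∀ ω, klSectorWeight L M β U μ K e₀ n (σ ω) = klSectorWeight L M β U μ K e₀ n ω)) (γ : DihedralGroup 4) (k k' : TorusSite 2 L) :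
    klLocCooperMatrix L M β U μ K e₀ n (d4Site γ k) (d4Site γ k') = klLocCooperMatrix L M β U μ K e₀ n k k' := by
  obtain ⟨σ, hsite, hw⟩ := hπ γ
  simp only [klLocCooperMatrix, Matrix.of_apply]
  -- reindex both sector sums by `π`
  rw [← Equiv.sum_comp σ]
  refine Finset.sum_congr rfl fun ω _ => ?_
  rw [← Equiv.sum_comp σ]
  refine Finset.sum_congr rfl fun ω' _ => ?_
  simp only [klLocArray, hsite, hw, (d4Site_injective γ).eq_iff, klCooperAmplitude_d4Site]

/-- The localised Cooper operator acts by the localised Cooper matrix (as D2's `cooperOp_apply`). -/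
theorem klLocCooperOp_apply (β U μ : ℝ) (K : TrigPolyC4v) (e₀ : ℝ) (n : ℕ)
    (v : EuclideanSpace ℂ (TorusSite 2 L)) (k : TorusSite 2 L) :
    klLocCooperOp L M β U μ K e₀ n v k = ∑ k', klLocCooperMatrix L M β U μ K e₀ n k k' * v k' := rfl

/-- **The localised Cooper operator commutes with the permutation representation** (under the sector-site equivariance hypothesis `hπ`). -/
theorem klLocCooperOp_comm {β U μ : ℝ} {K : TrigPolyC4v} {e₀ : ℝ} {n : ℕ}
    (hπ : ∀ γ : DihedralGroup 4, ∃ σ : Equiv.Perm (Fin (sectorCount (2 * n))),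
      (∀ ω, klSectorSite L μ n (σ ω) = d4Site γ (klSectorSite L μ n ω)) ∧
      (∀ ω, klSectorWeight L M β U μ K e₀ n (σ ω) = klSectorWeight L M β U μ K e₀ n ω)) (g : DihedralGroup 4) :
    klLocCooperOp L M β U μ K e₀ n * d4PermRep L g = d4PermRep L g * klLocCooperOp L M β U μ K e₀ n := by
  apply ContinuousLinearMap.ext
  intro v
  ext k
  change klLocCooperOp L M β U μ K e₀ n (d4PermRep L g v) k = d4PermRep L g (klLocCooperOp L M β U μ K e₀ n v) k
  rw [klLocCooperOp_apply, d4PermRep_apply, klLocCooperOp_apply]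
  simp_rw [d4PermRep_apply]
  rw [← Equiv.sum_comp (d4SitePerm (L := L) g) (fun k' => klLocCooperMatrix L M β U μ K e₀ n k k' * v (d4Site g⁻¹ k'))]
  refine Finset.sum_congr rfl fun j _ => ?_
  rw [d4SitePerm_apply, d4Site_inv_apply]
  congr 1
  conv_lhs => rw [← d4Site_apply_inv g k]
  exact klLocCooperMatrix_d4Site L M hπ g (d4Site g⁻¹ k) j

/-- The localised Cooper operator leaves every channel invariant (under the sector-site equivariance hypothesis `hπ`). -/
theorem klLocCooperOp_mapsTo {β U μ : ℝ} {K : TrigPolyC4v} {e₀ : ℝ} {n : ℕ}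
    (hπ : ∀ γ : DihedralGroup 4, ∃ σ : Equiv.Perm (Fin (sectorCount (2 * n))),
      (∀ ω, klSectorSite L μ n (σ ω) = d4Site γ (klSectorSite L μ n ω)) ∧
      (∀ ω, klSectorWeight L M β U μ K e₀ n (σ ω) = klSectorWeight L M β U μ K e₀ n ω)) (χ : D4Irrep) :
    ∀ v ∈ channelSubspace (d4PermRep L) χ, klLocCooperOp L M β U μ K e₀ n v ∈ channelSubspace (d4PermRep L) χ :=
  mapsTo_channelSubspace_of_comm (klLocCooperOp_comm L M hπ)

/-- **C2 applies to the localised blocks, bottom:** `klLocBlockInf … n χ = formInf (blockOp …)`. -/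
theorem klLocBlockInf_eq_formInf {β U μ : ℝ} {K : TrigPolyC4v} {e₀ : ℝ} {n : ℕ}
    (hπ : ∀ γ : DihedralGroup 4, ∃ σ : Equiv.Perm (Fin (sectorCount (2 * n))),
      (∀ ω, klSectorSite L μ n (σ ω) = d4Site γ (klSectorSite L μ n ω)) ∧
      (∀ ω, klSectorWeight L M β U μ K e₀ n (σ ω) = klSectorWeight L M β U μ K e₀ n ω)) (χ : D4Irrep) :
    klLocBlockInf L M β U μ K e₀ n χ =
      formInf (blockOp (d4PermRep L) χ (klLocCooperOp L M β U μ K e₀ n) (klLocCooperOp_mapsTo L M hπ χ)) :=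
  (formInf_blockOp _ _).symm

/-- **C2 applies to the localised blocks, top:** `klLocBlockSup … n χ = formSup (blockOp …)`. -/
theorem klLocBlockSup_eq_formSup {β U μ : ℝ} {K : TrigPolyC4v} {e₀ : ℝ} {n : ℕ}
    (hπ : ∀ γ : DihedralGroup 4, ∃ σ : Equiv.Perm (Fin (sectorCount (2 * n))),
      (∀ ω, klSectorSite L μ n (σ ω) = d4Site γ (klSectorSite L μ n ω)) ∧
      (∀ ω, klSectorWeight L M β U μ K e₀ n (σ ω) = klSectorWeight L M β U μ K e₀ n ω)) (χ : D4Irrep) :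
    klLocBlockSup L M β U μ K e₀ n χ =
      formSup (blockOp (d4PermRep L) χ (klLocCooperOp L M β U μ K e₀ n) (klLocCooperOp_mapsTo L M hπ χ)) :=
  (formSup_blockOp _ _).symm

/-- **Block-by-block control of the localised Cooper operator:** a common lower bound of the five `klLocBlockInf … n χ` bounds the
whole form from below (under the sector-site equivariance hypothesis `hπ`). -/
theorem le_formInf_klLocCooperOp {β U μ : ℝ} {K : TrigPolyC4v} {e₀ : ℝ} {n : ℕ}
    (hπ : ∀ γ : DihedralGroup 4, ∃ σ : Equiv.Perm (Fin (sectorCount (2 * n))),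
      (∀ ω, klSectorSite L μ n (σ ω) = d4Site γ (klSectorSite L μ n ω)) ∧
      (∀ ω, klSectorWeight L M β U μ K e₀ n (σ ω) = klSectorWeight L M β U μ K e₀ n ω)) {c : ℝ} (hc : ∀ χ, c ≤ klLocBlockInf L M β U μ K e₀ n χ) :
    c ≤ formInf (klLocCooperOp L M β U μ K e₀ n) := by
  haveI : Nontrivial (EuclideanSpace ℂ (TorusSite 2 L)) := by
    haveI : Nonempty (TorusSite 2 L) := ⟨fun _ => 0⟩
    infer_instance
  -- unitarity of the permutation representation (also `inner_d4PermRep` of `…CooperVertexBlocksModel`)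
  have hadj : ∀ (g : DihedralGroup 4) (x y : EuclideanSpace ℂ (TorusSite 2 L)),
      ⟪d4PermRep L g x, y⟫_ℂ = ⟪x, d4PermRep L g⁻¹ y⟫_ℂ := by
    intro g x y
    have hmul : d4PermRep L g * d4PermRep L g⁻¹ = 1 := by rw [← d4PermRep_mul, mul_inv_cancel, d4PermRep_one]
    have hy : d4PermRep L g (d4PermRep L g⁻¹ y) = y := by
      have h := congrArg (fun S : EuclideanSpace ℂ (TorusSite 2 L) →L[ℂ] EuclideanSpace ℂ (TorusSite 2 L) => S y) hmul
      exact h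
    conv_lhs => rw [← hy]
    exact (LinearIsometryEquiv.piLpCongrLeft 2 ℂ ℂ (d4SitePerm (L := L) g)).inner_map_map x _
  refine le_formInf_of_forall_channel (d4PermRep_mul L) (d4PermRep_one L) hadj (klLocCooperOp_comm L M hπ)
    fun χ w hw hwχ => (hc χ).trans ?_
  refine csInf_le ⟨-‖klLocCooperOp L M β U μ K e₀ n‖, ?_⟩ ⟨w, ⟨hw, hwχ⟩, rfl⟩
  rintro _ ⟨v, ⟨hv, -⟩, rfl⟩
  exact neg_le_of_abs_le (abs_re_inner_apply_le_norm _ hv)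

/-! ### hπ discharged: the regime versions (imports `KLProgrammeLocalisedCooperEquivariance`) -/

section Regime

variable {L M}
variable {β U μ : ℝ} {K : TrigPolyC4v} {e₀ : ℝ} {n : ℕ}

/-- **C2 applies to the localised blocks in the regime, bottom** (hπ discharged by `klLocCooper_sectorEquivariance`): for
`-4 < μ < 0`, `n ≥ 1` and a scale-`n` shell avoiding the origin and the zone boundary,
`klLocBlockInf … n χ = formInf (blockOp (d4PermRep L) χ (klLocCooperOp …) _)`. -/
theorem klLocBlockInf_eq_formInf_of_regime (hμ₁ : -4 < μ) (hμ₂ : μ < 0) (hn : 1 ≤ n)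
    (hsh : ∀ k ∈ momentumShell L (nambuXiCT L μ K) (klScale e₀ n), k ≠ 0 ∧ ∀ j, 2 * (k j).val ≠ L) (χ : D4Irrep) :
    klLocBlockInf L M β U μ K e₀ n χ =
      formInf (blockOp (d4PermRep L) χ (klLocCooperOp L M β U μ K e₀ n)
        (klLocCooperOp_mapsTo L M (klLocCooper_sectorEquivariance L M hμ₁ hμ₂ hn hsh) χ)) :=
  klLocBlockInf_eq_formInf L M (klLocCooper_sectorEquivariance L M hμ₁ hμ₂ hn hsh) χ

/-- **C2 applies to the localised blocks in the regime, top.** -/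
theorem klLocBlockSup_eq_formSup_of_regime (hμ₁ : -4 < μ) (hμ₂ : μ < 0) (hn : 1 ≤ n)
    (hsh : ∀ k ∈ momentumShell L (nambuXiCT L μ K) (klScale e₀ n), k ≠ 0 ∧ ∀ j, 2 * (k j).val ≠ L) (χ : D4Irrep) :
    klLocBlockSup L M β U μ K e₀ n χ =
      formSup (blockOp (d4PermRep L) χ (klLocCooperOp L M β U μ K e₀ n)
        (klLocCooperOp_mapsTo L M (klLocCooper_sectorEquivariance L M hμ₁ hμ₂ hn hsh) χ)) :=
  klLocBlockSup_eq_formSup L M (klLocCooper_sectorEquivariance L M hμ₁ hμ₂ hn hsh) χ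

/-- **The localised Cooper operator commutes with `D₄` in the regime** (hπ discharged). -/
theorem klLocCooperOp_comm_of_regime (hμ₁ : -4 < μ) (hμ₂ : μ < 0) (hn : 1 ≤ n)
    (hsh : ∀ k ∈ momentumShell L (nambuXiCT L μ K) (klScale e₀ n), k ≠ 0 ∧ ∀ j, 2 * (k j).val ≠ L) (g : DihedralGroup 4) :
    klLocCooperOp L M β U μ K e₀ n * d4PermRep L g = d4PermRep L g * klLocCooperOp L M β U μ K e₀ n :=
  klLocCooperOp_comm L M (klLocCooper_sectorEquivariance L M hμ₁ hμ₂ hn hsh) g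

/-- **Block-by-block control of the localised Cooper operator in the regime** (hπ discharged): a common lower bound of the
five `klLocBlockInf … n χ` bounds the whole form from below. -/
theorem le_formInf_klLocCooperOp_of_regime (hμ₁ : -4 < μ) (hμ₂ : μ < 0) (hn : 1 ≤ n)
    (hsh : ∀ k ∈ momentumShell L (nambuXiCT L μ K) (klScale e₀ n), k ≠ 0 ∧ ∀ j, 2 * (k j).val ≠ L) {c : ℝ}
    (hc : ∀ χ, c ≤ klLocBlockInf L M β U μ K e₀ n χ) :
    c ≤ formInf (klLocCooperOp L M β U μ K e₀ n) :=
  le_formInf_klLocCooperOp L M (klLocCooper_sectorEquivariance L M hμ₁ hμ₂ hn hsh) hc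

end Regime

end Summit.HubbardSuperconductivity.HubbardSuperconductivity.Theorems.KLProgrammeLegKernels

end
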